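/-
Copyright (c) 2026 the pub-hodgecm-mathlib formalisation cell (harness21).  Prover seat hodgecm-mathlib-K2E5-p17 (g5), Track B «K2-LIT» ∕ h413
(`stmt-HodgeConjecture-24833`), line `K2_E3_EllipticInputs`, road «GL₂-sc» (road owner K2E5-p17 (g5); dealer D66), brick (2E-a3): the `N = 2` twin of ★ (GL-6) part 2
`K2E3GL3BlockHenselCentralizer` (K2E3-p21 (g4)) — «HENSEL ⇒ SPLIT ⇒ UNBOUNDED CENTRALISER» for a near-upper-triangular `h ∈ GL₂(F)`.  2026-09-04.
-/
import Summits.HodgeConjecture.HodgeConjecture.Theorems.K2E3GL2SpectralIdempotentCentralizer   -- ★ (2E-a2) (this seat): idempotent ⇒ unbounded centraliser, spectral idempotent of a simple root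
import Summits.HodgeConjecture.HodgeConjecture.Theorems.K2E3LocalFieldSquaresHensel              -- ★ (K2E5-p10 (g4)): `exists_sq_add_mul_eq` (Hensel for `y² + a y = c`)
import Summits.HodgeConjecture.HodgeConjecture.Theorems.K2E3SplitTorusTwistModuleBound           -- ★ (K2E3-p20 (g4)): `v_le_iff_normAbs_le` (the `Valued.v` ∕ `normAbs` dictionary)
import HarnessLib

/-!
# Crux `H413` — K2-LIT E3, road «GL₂-sc», brick (2E-a3): a near-upper-triangular `h ∈ GL₂(F)` whose diagonal entries are separated has a SIMPLE RATIONAL EIGENVALUE,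
# hence (★ 2E-a2) an UNBOUNDED centraliser modulo the centre

Cell `hodgecm-mathlib`, Track B, line `K2_E3_EllipticInputs`, road «GL₂-sc» = Harish-Chandra's local integrability for supercuspidal `GL₂(F)` (letter (S-C′-GL₂sc), socket
`sig_K2E3GL2SupercuspidalCharLocInt`; road owner K2E5-p17 (g5), BRICK LIST v1.1 `K2/K2E5-p17/g5/BRICKLIST-GL2sc-v1.1.K2E5-p17-g5.md`).  The `N = 2` twin of ★ (GL-6) part 2
`K2E3GL3BlockHenselCentralizer` (K2E3-p21 (g4)): the contrapositive consumed by ★ (2F-a) `K2E3GL2ModCentre.exists_bound_of_isCompact_image` in the box-decay count (2E-a5).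
THEOREMS ONLY; count-neutral helper (`--supports stmt-HodgeConjecture-24833 --as helper`); no `σ`, no measure.

THE MATHEMATICS.  For `g ∈ 𝔤𝔩₂(F)`: `χ_g(g₀₀ + y) = y² + (g₀₀ − g₁₁)·y − g₀₁g₁₀`.  If `|g₀₁ g₁₀| < |g₀₀ − g₁₁|²` (here from `|gᵢⱼ| ≤ q^M`, `|g₀₁| ≤ q^{M−d}`, `|g₀₀ − g₁₁| ≥ q^{−k}`,
`d ≥ 2M + 2k + 1`), Hensel for the quadratic `y² + a y = c` (★ `exists_sq_add_mul_eq`, every residue characteristic) gives `y` with `|y|·|a| = |c|`, so `λ₀ = g₀₀ + y` is a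
root of `χ_g` with `χ_g′(λ₀) = a + 2y ≠ 0` (`|2y| ≤ |y| < |a|`): a SIMPLE RATIONAL EIGENVALUE (`exists_simple_root_of_upper_small`).  By ★ (2E-a2) the spectral idempotent of
`λ₀` lies in the centraliser of `h`, is `≠ 0, 1` (`h` is not scalar since `h₀₀ ≠ h₁₁`), and the pencil `ϖⁿ e + (1 − e)` makes the centraliser unbounded modulo scalars
(**`exists_centralizer_unbounded_of_upper_small`**).  At `N = 2` there is ONE shape only: the Cartan element `t_a = diag(ϖ^{−a}, 1)` shrinks the single upper entry.
[NeukirchANT1999, Ch. II §4 Lemma (4.6)]; [HarishChandra1970, Part VI §8 p. 60].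
HONEST LABEL: HC_CM is proved only modulo the 7 printed citations (2 remaining named inputs: hLiu418 = stmt-HodgeConjecture-24832, h413 =
stmt-HodgeConjecture-24833) until rung 0 closes; elementary, closes no organ by itself.
-/

set_option autoImplicit false
set_option linter.dupNamespace false   -- `Summit.HodgeConjecture.HodgeConjecture.…` (D-0017 nested layout; lakefile exemption for Summits)

noncomputable section

open Polynomial
open scoped MatrixGroups WithZero Valued NNReal
open Literature.NumberTheory.Automorphic Literature.NumberTheory.GaloisRepresentations Literature.NumberTheory.GaloisRepresentations.IsNonarchimedeanLocalField
open Summit.HodgeConjecture.HodgeConjecture.Cruxes.H413.K2E3GL2SpectralIdempotentCentralizer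

namespace Summit.HodgeConjecture.HodgeConjecture.Cruxes.H413.K2E3GL2HenselSplitCentralizer

variable {K : Type*} [Field K] [Valued K ℤᵐ⁰] [ValuativeRel K] [(Valued.v : Valuation K ℤᵐ⁰).Compatible] [IsNonarchimedeanLocalField K]

/-! ## §1  Hensel: a simple rational root of `χ_g` for upper-small, diagonal-separated `g ∈ 𝔤𝔩₂(F)` -/

/-- **HENSEL (upper entry small).**  `g ∈ 𝔤𝔩₂(F)` with entries `≤ q^M`, `|g₀₁| ≤ q^{M−d}`, `|g₀₀ − g₁₁| ≥ q^{−k}` and `d ≥ 2M + 2k + 1` ⟹ `χ_g` has a SIMPLE root `λ₀ ∈ F`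
(`χ_g(g₀₀ + y) = y² + (g₀₀ − g₁₁) y − g₀₁ g₁₀` and Hensel for the quadratic `y² + a y = c`, `|c| < |a|²`). [cite: NeukirchANT1999, Ch. II §4 Lemma (4.6)]
[cite: HarishChandra1970, Part VI §8 p. 60] -/
theorem exists_simple_root_of_upper_small (g : Matrix (Fin 2) (Fin 2) K) {M k d : ℕ} (hd : 2 * M + 2 * k + 1 ≤ d)
    (hall : ∀ i j, Valued.v (g i j) ≤ WithZero.exp (M : ℤ))
    (h01 : Valued.v (g 0 1) ≤ WithZero.exp ((M : ℤ) - d))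
    (hsep : WithZero.exp (-(k : ℤ)) ≤ Valued.v (g 0 0 - g 1 1)) :
    ∃ l₀ : K, g.charpoly.IsRoot l₀ ∧ g.charpoly.derivative.eval l₀ ≠ 0 := by
  set a : K := g 0 0 - g 1 1 with ha
  set c : K := g 0 1 * g 1 0 with hc
  -- `v c < v a ^ 2`
  have hva : WithZero.exp (-(k : ℤ)) ≤ Valued.v a := hsep
  have ha0 : a ≠ 0 := fun h0 => by
    rw [h0, map_zero] at hva
    exact absurd hva (not_le.2 WithZero.exp_pos)
  have hvc : Valued.v c < Valued.v (a ^ 2) := by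
    rw [hc, map_mul, map_pow]
    calc Valued.v (g 0 1) * Valued.v (g 1 0) ≤ WithZero.exp ((M : ℤ) - d) * WithZero.exp (M : ℤ) := mul_le_mul' h01 (hall 1 0)
      _ = WithZero.exp (2 * (M : ℤ) - d) := by rw [← WithZero.exp_add]; ring_nf
      _ < WithZero.exp (-(k : ℤ) + -(k : ℤ)) := WithZero.exp_lt_exp.2 (by omega)
      _ = WithZero.exp (-(k : ℤ)) ^ 2 := by rw [sq, WithZero.exp_add]
      _ ≤ Valued.v a ^ 2 := pow_le_pow_left' hva 2
  have hnc : normAbs K c < normAbs K a ^ 2 := by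
    rw [← map_pow]
    by_contra hle
    rw [not_lt, ← K2E3SplitTorusTwistModuleBound.v_le_iff_normAbs_le] at hle
    exact absurd hvc (not_lt.2 hle)
  -- Hensel for `y² + a y = c`
  obtain ⟨y, hy, hyn⟩ := K2E3LocalFieldSquaresHensel.exists_sq_add_mul_eq ha0 hnc
  -- `|y| < |a|`
  have hya : Valued.v y < Valued.v a := by
    have hna0 : 0 < normAbs K a := pos_iff_ne_zero.2 ((map_ne_zero (normAbs K)).2 ha0)
    have hlt : normAbs K y < normAbs K a := by
      by_contra hle
      rw [not_lt] at hle
      have : normAbs K a ^ 2 ≤ normAbs K c := by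
        rw [← hyn, sq]
        exact mul_le_mul' hle le_rfl
      exact absurd hnc (not_lt.2 this)
    by_contra hle
    rw [not_lt, K2E3SplitTorusTwistModuleBound.v_le_iff_normAbs_le] at hle
    exact absurd hlt (not_lt.2 hle)
  refine ⟨g 0 0 + y, ?_, ?_⟩
  · -- `χ_g(g₀₀ + y) = y² + a y − c = 0`
    rw [Polynomial.IsRoot, Matrix.charpoly_fin_two]
    simp only [eval_add, eval_sub, eval_mul, eval_pow, eval_C, eval_X, Matrix.trace_fin_two, Matrix.det_fin_two]
    have h := hy
    rw [ha, hc] at h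
    linear_combination h
  · -- `χ_g′(g₀₀ + y) = a + 2y ≠ 0` since `|2y| ≤ |y| < |a|`
    have h2 : Valued.v (2 : K) ≤ 1 := by
      rw [← one_add_one_eq_two]
      exact Valued.v.map_add_le (le_of_eq Valued.v.map_one) (le_of_eq Valued.v.map_one)
    have h2y : Valued.v (2 * y) < Valued.v a := by
      rw [map_mul]
      calc Valued.v (2 : K) * Valued.v y ≤ 1 * Valued.v y := mul_le_mul' h2 le_rfl
        _ = Valued.v y := one_mul _
        _ < Valued.v a := hya
    have hne : a + 2 * y ≠ 0 := fun h0 => by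
      have hsum : Valued.v (a + 2 * y) = Valued.v a := Valued.v.map_add_eq_of_lt_left h2y
      rw [h0, map_zero] at hsum
      exact ha0 ((Valuation.zero_iff _).1 hsum.symm)
    have hderiv : g.charpoly.derivative.eval (g 0 0 + y) = a + 2 * y := by
      rw [Matrix.charpoly_fin_two, Matrix.trace_fin_two]
      simp
      rw [ha]; ring
    rw [hderiv]
    exact hne

/-! ## §2  The head: upper-small, diagonal-separated `h ∈ GL₂(F)` has an unbounded centraliser modulo the centre -/

/-- **(2E-a3) «HENSEL ⇒ UNBOUNDED CENTRALISER» for `GL₂`.**  For `h ∈ GL₂(F)` with entries `≤ q^M`, `|h₀₁| ≤ q^{M−d}`, `|h₀₀ − h₁₁| ≥ q^{−k}` and `d ≥ 2M + 2k + 1`, the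
centraliser of `h` is unbounded modulo scalars: `∀ N, ∃ y ∈ Z(h), ∃ i j i′ j′, exp N < v(y_{ij})·v(y⁻¹_{i′j′})` — `h` has a simple rational eigenvalue (§1), hence a
non-trivial spectral idempotent in its centraliser (★ 2E-a2 `exists_idempotent_of_simple_root`; `h` is not scalar because `h₀₀ ≠ h₁₁`), hence the unbounded pencil
`ϖⁿ e + (1 − e)` (★ 2E-a2 `exists_centralizer_unbounded_of_idempotent`). [cite: HarishChandra1970, Part VI §8 p. 60] [cite: NeukirchANT1999, Ch. II §4 Lemma (4.6)] -/
theorem exists_centralizer_unbounded_of_upper_small {ϖ : K} (hϖ : Valued.v ϖ = WithZero.exp (-1 : ℤ)) {M k d : ℕ} (hd : 2 * M + 2 * k + 1 ≤ d)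
    (h : GL (Fin 2) K) (hall : ∀ i j, Valued.v ((h : Matrix (Fin 2) (Fin 2) K) i j) ≤ WithZero.exp (M : ℤ))
    (h01 : Valued.v ((h : Matrix (Fin 2) (Fin 2) K) 0 1) ≤ WithZero.exp ((M : ℤ) - d))
    (hsep : WithZero.exp (-(k : ℤ)) ≤ Valued.v ((h : Matrix (Fin 2) (Fin 2) K) 0 0 - (h : Matrix (Fin 2) (Fin 2) K) 1 1)) :
    ∀ N : ℕ, ∃ y : GL (Fin 2) K, y * h = h * y ∧ ∃ i j i' j' : Fin 2,
      WithZero.exp (N : ℤ) < Valued.v ((y : Matrix (Fin 2) (Fin 2) K) i j) * Valued.v (((y⁻¹ : GL (Fin 2) K) : Matrix (Fin 2) (Fin 2) K) i' j') := by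
  intro N
  obtain ⟨l₀, hroot, hsimple⟩ := exists_simple_root_of_upper_small (h : Matrix (Fin 2) (Fin 2) K) hd hall h01 hsep
  obtain ⟨e, he, hhe, he0, he1⟩ := exists_idempotent_of_simple_root (h : Matrix (Fin 2) (Fin 2) K) hroot hsimple
  refine exists_centralizer_unbounded_of_idempotent hϖ h he hhe he0 (fun h1 => ?_) N
  -- `e = 1 ⇒ h = λ₀·1 ⇒ h₀₀ = h₁₁`, contradicting the separation
  have hscal := he1 h1
  have hq : (h : Matrix (Fin 2) (Fin 2) K) 0 0 - (h : Matrix (Fin 2) (Fin 2) K) 1 1 = 0 := by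
    rw [hscal]; simp [Matrix.algebraMap_matrix_apply]
  rw [hq, map_zero] at hsep
  exact absurd hsep (not_le.2 WithZero.exp_pos)

end Summit.HodgeConjecture.HodgeConjecture.Cruxes.H413.K2E3GL2HenselSplitCentralizer

end
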